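import Summits.BirchSwinnertonDyer.BirchSwinnertonDyer.Theorems.ThetaPartnerAtTwoSignedMainConjectureCMTwoRankZeroPTDeepAdditiveIntegral
import HarnessLib

/-!
# Route `ThetaPartnerAtTwo` (TP2), crux K2R0P♭ (stmt-BirchSwinnertonDyer-26471; derived node K2r0P 24945), line `rankzero` v20,
# stub `stub_poitouTateDeepTwo` = (S_PT) — brick **B6c, part 3: the hypothesis (I)_bad of the stub-closer VERBATIM**
# («∀ n, ∀ x ∈ H¹(Γ_n, T_pA), ∀ bad w ≠ p, ∀ 𝔓 ∣ w, res_{Γ_n ⊓ I_𝔓}((p : ℤ_[p])^e • x) = 0», `e` uniform in `n`)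

HONEST FRAMING (cell `pub/bsd-wall`, W-ALL row 1; extra width seat `bsd-wall-tp2-p2-w5` g0, `--supports` only).
THEOREMS ONLY (no definition, no named fact, no instance, no `sorry`); closes no item; BSD is NOT proved by
any of this.  Sequel of `…PTDeepAdditiveInertia.lean` / `…PTDeepAdditiveIntegral.lean` (B6c parts 1–2): the
same uniform exponent, now (i) ONE exponent for ALL additive places at once, (ii) in the `p`-POWER form
`(p : ℤ_[p]) ^ e • x` of the lead's stub-closer (STATUS 2026-08-28T11:27:56Z, hypothesis (I)_bad), (iii) at
every layer `κ.layerSubgroup n` of any `ℤ_p`-extension, and (iv) for a CM curve with «bad» in place of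
«additive» (`hasAdditiveReductionAt_of_hasCM_of_not_hasGoodReductionAt`).

* `pow_factorization_smul_eq_zero_of_nsmul_eq_zero` — `E • z = 0 ⇒ (p : ℤ_[p]) ^ {v_p E} • z = 0` in a
  `ℤ_p`-module (the prime-to-`p` part of `E` is a unit; = `pow_factorization_smul_mem_of_nsmul_mem` at `⊥`).
* `exists_pow_smul_resLe_inertia_tate_eq_zero_of_forall_additive` — for `E/ℚ` elliptic, `p`, `κ`: ONE `e` with
  `res_{Γ_n ⊓ I_𝔓}((p : ℤ_[p]) ^ e • x) = 0` for every `n`, every `x ∈ H¹(Γ_n, T_pE)`, every ADDITIVE `w ≠ p`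
  and every `𝔓 ∣ w` (product of the per-place exponents of part 2 over the finite set of additive places).
* `exists_pow_smul_resLe_inertia_tate_eq_zero_of_hasCM` — the same for a CM curve at every BAD `w ≠ p`:
  hypothesis (I)_bad of the stub-closer, byte-shape `resLe (tateRep A p).toTopRep
  (inf_le_left : κ.layerSubgroup n ⊓ 𝔓.inertia Γ_ℚ ≤ κ.layerSubgroup n) 1 (((p : ℤ_[p]) ^ e) • x) = 0`.

References: [Kato2004Asterisque] §8.2, Lemma 8.5 (pp. 180–184), §12.2 (p. 220); [SilvermanATAEC1994]
Thm. IV.10.2(a) (PDF pp. 358–359), Thm. II.6.4 (PDF p. 148); [NeukirchANT1999] II §9 Prop. (9.6).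
-/

set_option autoImplicit false
-- the Theorems namespace of this sub repeats the summit name by design (D-0017 nested layout)
set_option linter.dupNamespace false

noncomputable section

open scoped Classical NumberField Pointwise
open CategoryTheory Function Field NumberField IsDedekindDomain IsDedekindDomain.HeightOneSpectrum
open Literature.NumberTheory.EllipticCurves Literature.NumberTheory.GaloisRepresentations
open Literature.NumberTheory.EllipticCurves.Kato2004
  Literature.NumberTheory.EllipticCurves.Kato2004.EulerSystemValues Rat.HeightOneSpectrum
open _root_.TopRep _root_.ContinuousCohomology

namespace Summit.BirchSwinnertonDyer.BirchSwinnertonDyer.Theorems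

namespace SignedLowerOffTwo.PTDeep

variable (W : WeierstrassCurve ℚ) [W.IsElliptic] (p : ℕ) [Fact p.Prime]

/-- `E • z = 0 ⇒ (p : ℤ_[p]) ^ {v_p(E)} • z = 0` in a `ℤ_p`-module (`E ≠ 0`): the prime-to-`p` part of `E`
is a unit of `ℤ_p` (`pow_factorization_smul_mem_of_nsmul_mem` for the submodule `⊥`). [folklore] -/
theorem pow_factorization_smul_eq_zero_of_nsmul_eq_zero {M : Type*} [AddCommGroup M] [Module ℤ_[p] M]
    {E : ℕ} (hE : E ≠ 0) {z : M} (h : E • z = 0) : (p : ℤ_[p]) ^ (E.factorization p) • z = 0 := by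
  rw [← Submodule.mem_bot ℤ_[p]] at h ⊢
  exact pow_factorization_smul_mem_of_nsmul_mem p ⊥ hE h

variable [ContinuousSMul ℤ_[p] (W.tateModule p)]

/-- **One `p`-power exponent for all additive places, every layer.**  For `E/ℚ` elliptic, `p` prime and a
`ℤ_p`-extension datum `κ` of `ℚ` there is `e : ℕ` such that for every layer `n`, every
`x ∈ H¹(ℚ_n, T_pE) = H1 (tateRep E p) (κ.layerSubgroup n)`, every ADDITIVE place `w ≠ p` and every prime
`𝔓 ∣ w` of `\bar ℤ`, the restriction of `(p : ℤ_[p]) ^ e • x` to `Gal(ℚ̄/ℚ_n) ⊓ I_𝔓` vanishes.  (Per place: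
part 2 `exists_nsmul_resLe_inertia_tate_eq_zero_of_hasAdditiveReductionAt` with `I_𝔓 ≤ Gal(ℚ̄/ℚ_n)` from
`ZpExtension.inertia_le_kerSubgroup`; the additive places are finitely many (`finite_badPlaces`), so the
product of their exponents works; `ℕ`-multiple ⇒ `p`-power multiple by the unit trick.)
[cite: SilvermanATAEC1994, Thm. IV.10.2(a), additive case (PDF pp. 358–359)]
[cite: Kato2004Asterisque, §8.2, Lemma 8.5 (pp. 180–184) and §12.2 (p. 220)] -/
theorem exists_pow_smul_resLe_inertia_tate_eq_zero_of_forall_additive (κ : ZpExtension ℚ p) :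
    ∃ e : ℕ, ∀ (n : ℕ) (x : H1 (tateRep W p) (κ.layerSubgroup n)) (w : HeightOneSpectrum (𝓞 ℚ)),
      ((primesEquiv w : Nat.Primes) : ℕ) ≠ p → W.HasAdditiveReductionAt w → ∀ 𝔓 ∈ w.primesAbove,
      resLe (tateRep W p).toTopRep
        (inf_le_left : κ.layerSubgroup n ⊓ 𝔓.inertia (absoluteGaloisGroup ℚ) ≤ κ.layerSubgroup n) 1
        (((p : ℤ_[p]) ^ e) • x) = 0 := by
  have hp : p.Prime := Fact.out
  -- the finite set of additive places and one exponent per place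
  have hfin : {v : HeightOneSpectrum (𝓞 ℚ) | W.HasAdditiveReductionAt v}.Finite :=
    (W.finite_badPlaces_holds (𝓞 ℚ)).subset fun v hv ↦
      WeierstrassCurve.HasAdditiveReductionAt.not_hasGoodReductionAt hv
  have key : ∀ v : HeightOneSpectrum (𝓞 ℚ), ∃ e : ℕ, 0 < e ∧
      ((p : 𝓞 ℚ) ∉ v.asIdeal → W.HasAdditiveReductionAt v → ∀ 𝔓 ∈ v.primesAbove,
        ∀ (U : Subgroup (absoluteGaloisGroup ℚ)), 𝔓.inertia (absoluteGaloisGroup ℚ) ≤ U →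
        ∀ (x : H1 (tateRep W p) U), resLe (tateRep W p).toTopRep
          (inf_le_left : U ⊓ 𝔓.inertia (absoluteGaloisGroup ℚ) ≤ U) 1 (e • x) = 0) := by
    intro v
    by_cases hpv : (p : 𝓞 ℚ) ∈ v.asIdeal
    · exact ⟨1, one_pos, fun h ↦ absurd hpv h⟩
    by_cases hadd : W.HasAdditiveReductionAt v
    · obtain ⟨e, he, h⟩ :=
        exists_nsmul_resLe_inertia_tate_eq_zero_of_hasAdditiveReductionAt W p hpv hadd
      exact ⟨e, he, fun _ _ ↦ h⟩
    · exact ⟨1, one_pos, fun _ h ↦ absurd h hadd⟩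
  choose e he hkey using key
  have hE : (∏ v ∈ hfin.toFinset, e v) ≠ 0 := (Finset.prod_pos fun v _ ↦ he v).ne'
  refine ⟨(∏ v ∈ hfin.toFinset, e v).factorization p, fun n x w hw hadd 𝔓 h𝔓 ↦ ?_⟩
  have hpw : (p : 𝓞 ℚ) ∉ w.asIdeal := WeierstrassCurve.natCast_not_mem_asIdeal_of_primesEquiv_ne hp hw
  have hIU : 𝔓.inertia (absoluteGaloisGroup ℚ) ≤ κ.layerSubgroup n :=
    (ZpExtension.inertia_le_kerSubgroup_holds ℚ p κ hpw h𝔓).trans (κ.kerSubgroup_le_layerSubgroup n)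
  rw [map_smul]
  refine pow_factorization_smul_eq_zero_of_nsmul_eq_zero p hE ?_
  have hwmem : w ∈ hfin.toFinset := hfin.mem_toFinset.mpr hadd
  obtain ⟨m, hm⟩ : e w ∣ ∏ v ∈ hfin.toFinset, e v := Finset.dvd_prod_of_mem e hwmem
  rw [hm, mul_nsmul, ← map_nsmul, hkey w hpw hadd 𝔓 h𝔓 _ hIU x, nsmul_zero]

/-- **Hypothesis (I)_bad of the stub-closer, for a CM curve** (lead tp2-p2 g10, STATUS 2026-08-28T11:27:56Z:
«∀ n, ∀ x ∈ H¹(Γ_n, T₂A), ∀ bad w ≠ 2, ∀ 𝔓 ∣ w, resLe (tateRep A 2).toTopRep (inf_le_left : Γ_n ⊓ I_𝔓 ≤ Γ_n) 1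
((2 : ℤ_[2])^e • x) = 0», `e` uniform in `n`).  For a CM elliptic curve `E/ℚ`, ANY prime `p` and ANY
`ℤ_p`-extension datum `κ`: there is `e : ℕ` such that for every layer `n`, every `x ∈ H¹(ℚ_n, T_pE)`, every
BAD place `w ≠ p` and every `𝔓 ∣ w`, `res_{Gal(ℚ̄/ℚ_n) ⊓ I_𝔓}((p : ℤ_[p]) ^ e • x) = 0` — every bad place of a
CM curve is additive (`hasAdditiveReductionAt_of_hasCM_of_not_hasGoodReductionAt`).
[cite: SilvermanATAEC1994, Thm. IV.10.2(a) (PDF pp. 358–359) and Thm. II.6.4 (PDF p. 148)]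
[cite: Kato2004Asterisque, §8.2, Lemma 8.5 (pp. 180–184) and §12.2 (p. 220)] -/
theorem exists_pow_smul_resLe_inertia_tate_eq_zero_of_hasCM (hCM : W.HasCM) (κ : ZpExtension ℚ p) :
    ∃ e : ℕ, ∀ (n : ℕ) (x : H1 (tateRep W p) (κ.layerSubgroup n)) (w : HeightOneSpectrum (𝓞 ℚ)),
      ((primesEquiv w : Nat.Primes) : ℕ) ≠ p → ¬ W.HasGoodReductionAt w → ∀ 𝔓 ∈ w.primesAbove,
      resLe (tateRep W p).toTopRep
        (inf_le_left : κ.layerSubgroup n ⊓ 𝔓.inertia (absoluteGaloisGroup ℚ) ≤ κ.layerSubgroup n) 1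
        (((p : ℤ_[p]) ^ e) • x) = 0 := by
  obtain ⟨e, h⟩ := exists_pow_smul_resLe_inertia_tate_eq_zero_of_forall_additive W p κ
  exact ⟨e, fun n x w hw hbad 𝔓 h𝔓 ↦
    h n x w hw (hasAdditiveReductionAt_of_hasCM_of_not_hasGoodReductionAt W hCM hbad) 𝔓 h𝔓⟩

end SignedLowerOffTwo.PTDeep

end Summit.BirchSwinnertonDyer.BirchSwinnertonDyer.Theorems

end
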